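import Mathlib
import Literature.Probability.MarkovChains.MetropolisHastings
import Literature.Probability.MarkovChains.TotalVariation
import Summits.Ventures.LatticeQCDFlow.Exactness.FlowMCMC
import Summits.Ventures.LatticeQCDFlow.Exactness.JarzynskiFinite
import Summits.Ventures.LatticeQCDFlow.Scaling.ImportanceWeights
import Summits.Ventures.LatticeQCDFlow.Scaling.SectorBudget
import Summits.Ventures.LatticeQCDFlow.Scaling.StochasticFlows

/-!
# LatticeQCDFlow / Scaling — endpoint budgets for stochastic flows / NE-MCMC (T2-T) and the
# perfect-relaxation law (T2-W)

HONEST FRAMING: exact (Metropolis-corrected) sampling algorithms for lattice gauge theory;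
figures of merit are autocorrelation/cost numbers at stated couplings and volumes; no
continuum-physics claim.

Venture `LatticeQCDFlow` (cell pub-lqcd), topic `Scaling`, THEORY-2.md §3.5 / §4 T2-T, T2-W
(v1.5), landed by FANOUT row 31 from `HOME/THEORY-2-Sketch.lean` v1.5 (theory seat), rebased on
row 30's `Exactness/{FlowMCMC, JarzynskiFinite}.lean` and row 31's `Scaling/{ImportanceWeights,
SectorBudget, StochasticFlows}.lean`.  Every no-free-lunch statement proved for a deterministic
flow with model law `q` transfers to a stochastic flow with `q :=` the law `q_n` of the
trajectory ENDPOINT, because path space coarse-grains onto the endpoint (data processing):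

* `essFrac_eq_sq_div`, `essFrac_nonneg`, `essFrac_self`; `accRate_le_accRate_coarse` (the
  stationary IMH acceptance cannot increase under any coarse-graining), `sum_filter_mem_eq_sum_coarse`;
* `essFrac_path_eq` — the NE-MCMC importance weights are `P_R/P_F = (Z_0/Z_n) e^{−W}`, so its
  reweighting ESS is the printed `ÊSS = ⟨e^{−W}⟩²/⟨e^{−2W}⟩` (arXiv:2510.25704 §2.1);
* T2-T: `ess_path_le_ess_endpoint` (`ÊSS ≤ ESS(p_n, q_n)`), `kl_endpoint_le_kl_path`,
  `kl_path_eq_dissipation` (`D(P_F‖P_R) = ⟨W⟩_F − ΔF`), `dissipation_nonneg` (second law),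
  `kl_endpoint_le_dissipation` (Vaikuntanathan–Jarzynski lag inequality), `acc_path_le_acc_endpoint`,
  `path_sector_mixing_lower_bound` (T2-D on cylinder sets: an endpoint law that under-weights a
  topological sector `B` by `q_n(B)` costs `≳ p_n(B)/q_n(B)` NE-MCMC steps);
* T2-W: `ess_perfect_relaxation` — with PERFECTLY relaxing layers `ÊSS = ∏_k ESS(p_{k+1}, p_k)`
  exactly (`Theory2.essFrac_blockProd`), `ess_perfect_relaxation_le` (`≤ exp(−Σ_k D(p_{k+1}‖p_k))`):
  the printed `exp(−k′ n_dof/n_step)` law as a theorem about the MODEL with perfect relaxation —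
  NOT a bound over all stationary kernels (THEORY-2.md §3.5; conjecture C3′).
-/

namespace Summit.Ventures.LatticeQCDFlow.Theory2

open Finset
open Literature.Probability.MarkovChains
open Summit.Ventures.LatticeQCDFlow.Exactness

variable {X : Type*} [Fintype X]

section MoreESS


/-- `ESS/N = (Σ p)² / Σ p²/q` (no normalisation needed). [folklore] -/
theorem essFrac_eq_sq_div {p q : X → ℝ} (hq : ∀ x, q x ≠ 0) :
    essFrac p q = (∑ x, p x) ^ 2 / ∑ x, p x ^ 2 / q x := by
  unfold essFrac
  rw [show ∑ x, q x * weight p q x = ∑ x, p x from sum_congr rfl fun x _ => mul_weight (hq x),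
    show ∑ x, q x * weight p q x ^ 2 = ∑ x, p x ^ 2 / q x from
      sum_congr rfl fun x _ => by rw [mul_weight_sq (hq x), mul_weight_eq_sq_div]]

/-- `0 ≤ ESS/N`. [folklore] -/
theorem essFrac_nonneg {p q : X → ℝ} (hq : ∀ x, 0 ≤ q x) : 0 ≤ essFrac p q :=
  div_nonneg (sq_nonneg _) (sum_nonneg fun x _ => mul_nonneg (hq x) (sq_nonneg _))

/-- `ESS(g, g) = 1`. [folklore] -/
theorem essFrac_self {g : X → ℝ} (hg : ∀ x, 0 < g x) (hg1 : ∑ x, g x = 1) : essFrac g g = 1 := by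
  rw [essFrac_eq_sq_div (fun x => (hg x).ne'), hg1, one_pow]
  have h : ∀ x, g x ^ 2 / g x = g x := fun x => by rw [sq, mul_div_cancel_right₀ _ (hg x).ne']
  simp_rw [h, hg1, div_one]

/-- **m-block ESS product law without normalisation hypotheses** (the landed
`Theory2.essFrac_blockProd` assumes normalised target blocks): for product target and product
model over `m` blocks the reweighting ESS is the PRODUCT of the block ESS's. [folklore] -/
theorem essFrac_blockProd_of_pos {m : ℕ} {Z : Type*} [Fintype Z] {pb qb : Fin m → Z → ℝ}
    (hq : ∀ i z, 0 < qb i z) :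
    essFrac (blockProd pb) (blockProd qb) = ∏ i, essFrac (pb i) (qb i) := by
  rw [essFrac_eq_sq_div (fun φ => (blockProd_pos hq φ).ne'),
    prod_congr rfl fun i _ => essFrac_eq_sq_div (p := pb i) (fun z => (hq i z).ne'),
    prod_div_distrib, prod_pow, sum_blockProd]
  congr 1
  have h : ∀ φ, blockProd pb φ ^ 2 / blockProd qb φ =
      blockProd (fun i z => pb i z ^ 2 / qb i z) φ := by
    intro φ
    unfold blockProd
    rw [prod_div_distrib, prod_pow]
  simp_rw [h]
  exact sum_blockProd _

end MoreESS

section AccCoarse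


variable {Y : Type*} [Fintype Y] [DecidableEq Y]

/-- **L-7 (acceptance cannot increase under coarse-graining; proved).**  The stationary
independence-Metropolis acceptance `Σ_{x,y} min(p x q y, p y q x)` is at most the same quantity
for the push-forwards along any `π` (sum of minima ≤ minimum of sums, fibre by fibre).  With
`Theory2.accRate_le` this gives `acc ≤ 1 − ‖π_* p − π_* q‖_TV` — e.g. `π` = topological charge
of the ENDPOINT of a stochastic flow. [folklore] -/
theorem accRate_le_accRate_coarse (π : X → Y) (p q : X → ℝ) :
    accRate p q ≤ accRate (coarse π p) (coarse π q) := by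
  unfold accRate coarse
  rw [← sum_fiberwise univ π (fun x => ∑ y, min (p x * q y) (p y * q x))]
  refine sum_le_sum fun a _ => ?_
  have hin : ∀ x, ∑ y, min (p x * q y) (p y * q x) =
      ∑ b, ∑ y ∈ univ.filter (fun y => π y = b), min (p x * q y) (p y * q x) :=
    fun x => (sum_fiberwise univ π _).symm
  simp_rw [hin]
  rw [sum_comm]
  refine sum_le_sum fun b _ => ?_
  refine le_min ?_ ?_
  · calc ∑ x ∈ univ.filter (fun x => π x = a), ∑ y ∈ univ.filter (fun y => π y = b),
            min (p x * q y) (p y * q x)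
        ≤ ∑ x ∈ univ.filter (fun x => π x = a), ∑ y ∈ univ.filter (fun y => π y = b),
            p x * q y := sum_le_sum fun x _ => sum_le_sum fun y _ => min_le_left _ _
      _ = (∑ x ∈ univ.filter (fun x => π x = a), p x) *
            ∑ y ∈ univ.filter (fun y => π y = b), q y := by rw [sum_mul_sum]
  · calc ∑ x ∈ univ.filter (fun x => π x = a), ∑ y ∈ univ.filter (fun y => π y = b),
            min (p x * q y) (p y * q x)
        ≤ ∑ x ∈ univ.filter (fun x => π x = a), ∑ y ∈ univ.filter (fun y => π y = b),
            p y * q x := sum_le_sum fun x _ => sum_le_sum fun y _ => min_le_right _ _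
      _ = (∑ y ∈ univ.filter (fun y => π y = b), p y) *
            ∑ x ∈ univ.filter (fun x => π x = a), q x := by rw [sum_mul_sum, sum_comm]

omit [Fintype Y] in
/-- Mass of a cylinder / pre-image set = mass of the coarse-grained law. [folklore] -/
theorem sum_filter_mem_eq_sum_coarse (π : X → Y) (p : X → ℝ) (B : Finset Y) :
    ∑ x ∈ univ.filter (fun x => π x ∈ B), p x = ∑ y ∈ B, coarse π p y := by
  unfold coarse
  rw [← sum_fiberwise_of_maps_to (s := univ.filter (fun x => π x ∈ B)) (t := B) (g := π)
    (fun x hx => (mem_filter.mp hx).2) p]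
  refine sum_congr rfl fun y hy => sum_congr ?_ fun _ _ => rfl
  ext x
  simp only [mem_filter, mem_univ, true_and]
  exact ⟨fun h => h.2, fun h => ⟨h ▸ hy, h⟩⟩

end AccCoarse

section PathBudgets

variable {n : ℕ}

/-! ### Endpoint budgets: the path-space sampler is no better than its endpoint law -/

/-- The importance weights of NE-MCMC are `P_R/P_F = (Z_0/Z_n) e^{−W}`, so its reweighting ESS is
the printed `ÊSS = ⟨e^{−W}⟩² / ⟨e^{−2W}⟩` (arXiv:2510.25704 §2.1). [folklore] -/
theorem essFrac_path_eq [Nonempty X] (S : Fin (n+1) → X → ℝ) {P : Fin n → X → X → ℝ}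
    (hPpos : ∀ k x y, 0 < P k x y) :
    essFrac (revPathLaw S P) (pathLaw (gibbsLaw (S 0)) P) =
      (∑ ω, pathLaw (gibbsLaw (S 0)) P ω * Real.exp (-(work S ω))) ^ 2 /
        ∑ ω, pathLaw (gibbsLaw (S 0)) P ω * Real.exp (-(work S ω)) ^ 2 := by
  have hZ0 : partitionFn (S 0) ≠ 0 := (partitionFn_pos (S 0)).ne'
  have hZn : partitionFn (S (Fin.last n)) ≠ 0 := (partitionFn_pos (S _)).ne'
  have hc : partitionFn (S 0) / partitionFn (S (Fin.last n)) ≠ 0 := div_ne_zero hZ0 hZn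
  have hF : ∀ ω, pathLaw (gibbsLaw (S 0)) P ω ≠ 0 := fun ω => (pathLaw_pos (gibbsLaw_pos (S 0)) hPpos ω).ne'
  have hR : ∀ ω, revPathLaw S P ω =
      partitionFn (S 0) / partitionFn (S (Fin.last n)) * (pathLaw (gibbsLaw (S 0)) P ω * Real.exp (-(work S ω))) := by
    intro ω
    rw [crooks_pathwise S P ω, ← mul_assoc, div_mul_div_comm, mul_comm (partitionFn (S 0)),
      div_self (mul_ne_zero hZn hZ0), one_mul]
  rw [essFrac_eq_sq_div hF]
  simp_rw [hR]
  rw [← mul_sum, mul_pow]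
  have h2 : ∀ ω, (partitionFn (S 0) / partitionFn (S (Fin.last n)) *
      (pathLaw (gibbsLaw (S 0)) P ω * Real.exp (-(work S ω)))) ^ 2 / pathLaw (gibbsLaw (S 0)) P ω =
      (partitionFn (S 0) / partitionFn (S (Fin.last n))) ^ 2 *
        (pathLaw (gibbsLaw (S 0)) P ω * Real.exp (-(work S ω)) ^ 2) := by
    intro ω
    rw [div_eq_iff (hF ω)]
    ring
  simp_rw [h2]
  rw [← mul_sum, mul_div_mul_left _ _ (pow_ne_zero 2 hc)]

/-- **T2-T (ESS endpoint budget; proved).**  The reweighting ESS of NE-MCMC / a stochastic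
normalizing flow is at most the ESS of the TRUE final law `p_n = e^{−S_n}/Z_n` against the ACTUAL
law `q_n` of the trajectory endpoint: `ÊSS ≤ ESS(p_n, q_n)`.  Hence every v1.1–v1.4 ESS budget
(sector weights `SectorWeightBudget`, concentration `ConcentrationBudget`, block defects) applies
to stochastic flows with `q := q_n`. [folklore: data processing for χ² along `ω ↦ ω_n`] -/
theorem ess_path_le_ess_endpoint [Nonempty X] [DecidableEq X] (S : Fin (n+1) → X → ℝ)
    (P : Fin n → X → X → ℝ) (hP : ∀ k, IsRowStochastic (P k)) (hPpos : ∀ k x y, 0 < P k x y)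
    (hst : ∀ k : Fin n, IsStationary (fun x => Real.exp (-(S k.succ x))) (P k)) :
    essFrac (revPathLaw S P) (pathLaw (gibbsLaw (S 0)) P) ≤
      essFrac (gibbsLaw (S (Fin.last n)))
        (coarse (fun ω : Fin (n+1) → X => ω (Fin.last n)) (pathLaw (gibbsLaw (S 0)) P)) := by
  have h := essFrac_le_essFrac_coarse (fun ω : Fin (n+1) → X => ω (Fin.last n))
    (sum_revPathLaw S P hst) (pathLaw_pos (gibbsLaw_pos (S 0)) hPpos)
    (by rw [sum_pathLaw _ _ (fun k => (hP k).2), sum_gibbsLaw]) (fun x => ⟨fun _ => x, rfl⟩)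
  rwa [coarse_last_revPathLaw S P hst] at h

/-- **T2-T (KL endpoint budget; proved).**  `D(p_n ‖ q_n) ≤ D(P_R ‖ P_F)`. [folklore] -/
theorem kl_endpoint_le_kl_path [Nonempty X] [DecidableEq X] (S : Fin (n+1) → X → ℝ)
    (P : Fin n → X → X → ℝ) (hP : ∀ k, IsRowStochastic (P k)) (hPpos : ∀ k x y, 0 < P k x y)
    (hst : ∀ k : Fin n, IsStationary (fun x => Real.exp (-(S k.succ x))) (P k)) :
    klFin (gibbsLaw (S (Fin.last n)))
        (coarse (fun ω : Fin (n+1) → X => ω (Fin.last n)) (pathLaw (gibbsLaw (S 0)) P)) ≤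
      klFin (revPathLaw S P) (pathLaw (gibbsLaw (S 0)) P) := by
  have h := klFin_coarse_le (fun ω : Fin (n+1) → X => ω (Fin.last n))
    (p := revPathLaw S P) (q := pathLaw (gibbsLaw (S 0)) P)
    (revPathLaw_nonneg S (fun k => (hP k).1)) (pathLaw_pos (gibbsLaw_pos (S 0)) hPpos)
  rwa [coarse_last_revPathLaw S P hst] at h

/-- **T2-T (dissipation identity; proved).**  `D(P_F ‖ P_R) = ⟨W⟩_F − ΔF` with
`ΔF = −log(Z_n/Z_0)` (arXiv:2510.25704 eq. for `D_KL(q₀P_f ‖ p P_r) = ⟨W_d⟩_f`; Gaspard 2022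
eq. (5.21)). [folklore] -/
theorem kl_path_eq_dissipation [Nonempty X] (S : Fin (n+1) → X → ℝ) (P : Fin n → X → X → ℝ)
    (hP : ∀ k, IsRowStochastic (P k)) (hPpos : ∀ k x y, 0 < P k x y) :
    klFin (pathLaw (gibbsLaw (S 0)) P) (revPathLaw S P) =
      (∑ ω, pathLaw (gibbsLaw (S 0)) P ω * work S ω) +
        Real.log (partitionFn (S (Fin.last n)) / partitionFn (S 0)) := by
  have hq : 0 < partitionFn (S (Fin.last n)) / partitionFn (S 0) := div_pos (partitionFn_pos (S _)) (partitionFn_pos (S 0))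
  have key : ∀ ω, pathLaw (gibbsLaw (S 0)) P ω / revPathLaw S P ω =
      partitionFn (S (Fin.last n)) / partitionFn (S 0) * Real.exp (work S ω) := by
    intro ω
    have hc := crooks_pathwise S P ω
    have hR := revPathLaw_pos S hPpos ω
    have hE : Real.exp (-(work S ω)) * Real.exp (work S ω) = 1 := by
      rw [← Real.exp_add, neg_add_cancel, Real.exp_zero]
    rw [div_eq_iff hR.ne']
    calc pathLaw (gibbsLaw (S 0)) P ω
        = pathLaw (gibbsLaw (S 0)) P ω * (Real.exp (-(work S ω)) * Real.exp (work S ω)) := by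
          rw [hE, mul_one]
      _ = pathLaw (gibbsLaw (S 0)) P ω * Real.exp (-(work S ω)) * Real.exp (work S ω) := by ring
      _ = partitionFn (S (Fin.last n)) / partitionFn (S 0) * revPathLaw S P ω * Real.exp (work S ω) := by
          rw [hc]
      _ = partitionFn (S (Fin.last n)) / partitionFn (S 0) * Real.exp (work S ω) * revPathLaw S P ω := by ring
  have hlog : ∀ ω, Real.log (pathLaw (gibbsLaw (S 0)) P ω / revPathLaw S P ω) =
      work S ω + Real.log (partitionFn (S (Fin.last n)) / partitionFn (S 0)) := by
    intro ω
    rw [key, Real.log_mul hq.ne' (Real.exp_pos _).ne', Real.log_exp, add_comm]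
  unfold klFin
  simp_rw [hlog, mul_add, sum_add_distrib, ← sum_mul, sum_pathLaw _ _ (fun k => (hP k).2), sum_gibbsLaw, one_mul]

/-- **T2-T (second law; proved).**  `⟨W⟩_F ≥ ΔF`. [folklore] -/
theorem dissipation_nonneg [Nonempty X] (S : Fin (n+1) → X → ℝ) (P : Fin n → X → X → ℝ)
    (hP : ∀ k, IsRowStochastic (P k)) (hPpos : ∀ k x y, 0 < P k x y)
    (hst : ∀ k : Fin n, IsStationary (fun x => Real.exp (-(S k.succ x))) (P k)) :
    0 ≤ (∑ ω, pathLaw (gibbsLaw (S 0)) P ω * work S ω) +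
        Real.log (partitionFn (S (Fin.last n)) / partitionFn (S 0)) := by
  rw [← kl_path_eq_dissipation S P hP hPpos]
  unfold klFin
  exact Literature.InformationTheory.Entropy.sum_mul_log_div_nonneg (pathLaw_nonneg (fun x => (gibbsLaw_pos (S 0) x).le) (fun k => (hP k).1))
    (revPathLaw_pos S hPpos) (by rw [sum_pathLaw _ _ (fun k => (hP k).2), sum_gibbsLaw, sum_revPathLaw S P hst])

/-- **T2-T (lag inequality; proved).**  The mean dissipated work bounds the forward KL of the
ENDPOINT law from the target: `D(q_n ‖ p_n) ≤ ⟨W⟩_F − ΔF` (Vaikuntanathan–Jarzynski 2009;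
arXiv:2510.25704 eq. `D_KL(q‖p) ≤ D_KL(q₀P_f‖pP_r)`). [folklore] -/
theorem kl_endpoint_le_dissipation [Nonempty X] [DecidableEq X] (S : Fin (n+1) → X → ℝ)
    (P : Fin n → X → X → ℝ) (hP : ∀ k, IsRowStochastic (P k)) (hPpos : ∀ k x y, 0 < P k x y)
    (hst : ∀ k : Fin n, IsStationary (fun x => Real.exp (-(S k.succ x))) (P k)) :
    klFin (coarse (fun ω : Fin (n+1) → X => ω (Fin.last n)) (pathLaw (gibbsLaw (S 0)) P))
        (gibbsLaw (S (Fin.last n))) ≤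
      (∑ ω, pathLaw (gibbsLaw (S 0)) P ω * work S ω) +
        Real.log (partitionFn (S (Fin.last n)) / partitionFn (S 0)) := by
  rw [← kl_path_eq_dissipation S P hP hPpos]
  have h := klFin_coarse_le (fun ω : Fin (n+1) → X => ω (Fin.last n))
    (p := pathLaw (gibbsLaw (S 0)) P) (q := revPathLaw S P)
    (pathLaw_nonneg (fun x => (gibbsLaw_pos (S 0) x).le) (fun k => (hP k).1)) (revPathLaw_pos S hPpos)
  rwa [coarse_last_revPathLaw S P hst] at h

/-- **T2-T (acceptance endpoint budget; proved).**  Used as a Metropolis proposal (accept with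
`min(1, e^{−(W′−W)})`, arXiv:2510.25704 §2.1), NE-MCMC is the independence sampler on PATH space
with target `P_R` and proposal `P_F`; its stationary acceptance is at most that of the endpoint
pair `(p_n, q_n)`, hence `≤ 1 − ‖p_n − q_n‖_TV` (`Theory2.accRate_le`). [folklore] -/
theorem acc_path_le_acc_endpoint [Nonempty X] [DecidableEq X] (S : Fin (n+1) → X → ℝ)
    (P : Fin n → X → X → ℝ)
    (hst : ∀ k : Fin n, IsStationary (fun x => Real.exp (-(S k.succ x))) (P k)) :
    accRate (revPathLaw S P) (pathLaw (gibbsLaw (S 0)) P) ≤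
      accRate (gibbsLaw (S (Fin.last n)))
        (coarse (fun ω : Fin (n+1) → X => ω (Fin.last n)) (pathLaw (gibbsLaw (S 0)) P)) := by
  have h := accRate_le_accRate_coarse (fun ω : Fin (n+1) → X => ω (Fin.last n))
    (revPathLaw S P) (pathLaw (gibbsLaw (S 0)) P)
  rwa [coarse_last_revPathLaw S P hst] at h

/-- **T2-T (sector mixing floor for stochastic flows; proved).**  T2-D on path space with the
cylinder set `{ω : ω_n ∈ B}`: if the path-space IMH chain started from `μ` is `ε`-close to `P_R`
at time `t`, then `p_n(B) − μ(ω_n ∈ B) − ε ≤ t · q_n(B)` — an endpoint law that under-weights a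
topological sector `B` by `q_n(B)` costs `≳ p_n(B)/q_n(B)` NE-MCMC steps (each of `n` MC layers).
[folklore] -/
theorem path_sector_mixing_lower_bound [Nonempty X] [DecidableEq X] (S : Fin (n+1) → X → ℝ)
    (P : Fin n → X → X → ℝ) (hP : ∀ k, IsRowStochastic (P k)) (hPpos : ∀ k x y, 0 < P k x y)
    (hst : ∀ k : Fin n, IsStationary (fun x => Real.exp (-(S k.succ x))) (P k))
    {μ : (Fin (n+1) → X) → ℝ} (hμ : ∀ ω, 0 ≤ μ ω) (hμ1 : ∑ ω, μ ω = 1) (B : Finset X)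
    {t : ℕ} {ε : ℝ}
    (h : tvDist (lawAt (imhKernel (revPathLaw S P) (pathLaw (gibbsLaw (S 0)) P)) μ t)
      (revPathLaw S P) ≤ ε) :
    (∑ y ∈ B, gibbsLaw (S (Fin.last n)) y) -
        (∑ y ∈ B, coarse (fun ω : Fin (n+1) → X => ω (Fin.last n)) μ y) - ε ≤
      t * ∑ y ∈ B, coarse (fun ω : Fin (n+1) → X => ω (Fin.last n)) (pathLaw (gibbsLaw (S 0)) P) y := by
  have key := imh_sector_mixing_lower_bound (revPathLaw_pos S hPpos) (sum_revPathLaw S P hst)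
    (pathLaw_nonneg (fun x => (gibbsLaw_pos (S 0) x).le) (fun k => (hP k).1))
    (by rw [sum_pathLaw _ _ (fun k => (hP k).2), sum_gibbsLaw]) hμ hμ1
    (univ.filter (fun ω : Fin (n+1) → X => ω (Fin.last n) ∈ B)) h
  simp only [sum_filter_mem_eq_sum_coarse] at key
  rwa [coarse_last_revPathLaw S P hst] at key

/-! ### T2-W: the perfect-relaxation law (the model in which the printed `n_step ∝ n_dof` law
for stochastic flows is a theorem), and why it is not a lower bound for all kernels -/

/-- The `exp(−S_k)`-reversal of the PERFECT-RELAXATION kernel `P(x, ·) = e^{−S_k}/Z_k` is the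
same independent resampling, read backwards. -/
theorem revKernel_perfect [Nonempty X] (S : Fin (n+1) → X → ℝ) (k : Fin (n+1)) (y x : X) :
    revKernel (fun z => Real.exp (-(S k z))) (fun _ z => gibbsLaw (S k) z) y x = gibbsLaw (S k) x := by
  have hy : Real.exp (-(S k y)) ≠ 0 := (Real.exp_pos _).ne'
  simp only [revKernel, gibbsLaw]
  rw [show Real.exp (-(S k x)) * (Real.exp (-(S k y)) / partitionFn (S k)) / Real.exp (-(S k y)) =
      Real.exp (-(S k x)) / partitionFn (S k) * (Real.exp (-(S k y)) / Real.exp (-(S k y))) by ring,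
    div_self hy, mul_one]

/-- Under perfect relaxation the forward path law is the block product of the Gibbs laws `p_0, …, p_n`. [folklore] -/
theorem pathLaw_perfect [Nonempty X] (S : Fin (n+1) → X → ℝ) (ω : Fin (n+1) → X) :
    pathLaw (gibbsLaw (S 0)) (fun k _ y => gibbsLaw (S k.succ) y) ω = blockProd (fun i => gibbsLaw (S i)) ω := by
  simp only [pathLaw, transProb, blockProd]
  exact (Fin.prod_univ_succ fun i => gibbsLaw (S i) (ω i)).symm

/-- Under perfect relaxation the reverse path law is the block product `p_1 ⊗ … ⊗ p_n ⊗ p_n`. [folklore] -/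
theorem revPathLaw_perfect [Nonempty X] (S : Fin (n+1) → X → ℝ) (ω : Fin (n+1) → X) :
    revPathLaw S (fun k _ y => gibbsLaw (S k.succ) y) ω =
      blockProd (Fin.snoc (fun k : Fin n => gibbsLaw (S k.succ)) (gibbsLaw (S (Fin.last n))) :
        Fin (n+1) → X → ℝ) ω := by
  simp only [revPathLaw, blockProd, revKernel_perfect]
  rw [Fin.prod_univ_castSucc]
  simp only [Fin.snoc_castSucc, Fin.snoc_last]
  ring

/-- **T2-W (perfect-relaxation law; proved).**  If every MC layer of the protocol relaxes
PERFECTLY (independent resampling from `e^{−S_{k+1}}/Z_{k+1}`), the NE-MCMC reweighting ESS is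
EXACTLY the product over protocol steps of the one-step reweighting ESS's
`ESS(p_{k+1}, p_k)`.  With `Theory2.essFrac_le_exp_neg_kl` and the block laws this is
`ÊSS ≤ exp(−Σ_k D(p_{k+1} ‖ p_k))` — extensive in the volume at fixed protocol, `∝ V/n_step` for
a linear β-protocol (thermodynamic-length asymptotics): the printed `exp(−k′ n_dof/n_step)` law
(arXiv:2510.25704 §3.1; Bulgarelli–Cellini–Nada 2025) as a theorem about the MODEL with perfect
relaxation. It is NOT a lower bound over all stationary kernels (THEORY-2.md §3.5: the reflection
protocol has `W ≡ ΔF`, `ESS = 1`). [folklore] -/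
theorem ess_perfect_relaxation [Nonempty X] [DecidableEq X] (S : Fin (n+1) → X → ℝ) :
    essFrac (revPathLaw S (fun k _ y => gibbsLaw (S k.succ) y))
        (pathLaw (gibbsLaw (S 0)) (fun k _ y => gibbsLaw (S k.succ) y)) =
      ∏ k : Fin n, essFrac (gibbsLaw (S k.succ)) (gibbsLaw (S k.castSucc)) := by
  rw [show revPathLaw S (fun k _ y => gibbsLaw (S k.succ) y) =
      blockProd (Fin.snoc (fun k : Fin n => gibbsLaw (S k.succ)) (gibbsLaw (S (Fin.last n))) :
        Fin (n+1) → X → ℝ) from funext (revPathLaw_perfect S),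
    show pathLaw (gibbsLaw (S 0)) (fun k _ y => gibbsLaw (S k.succ) y) = blockProd (fun i => gibbsLaw (S i)) from
      funext (pathLaw_perfect S),
    essFrac_blockProd_of_pos (fun i x => gibbsLaw_pos (S i) x), Fin.prod_univ_castSucc]
  simp only [Fin.snoc_castSucc, Fin.snoc_last]
  rw [essFrac_self (gibbsLaw_pos (S _)) (sum_gibbsLaw (S _)), mul_one]

/-- **T2-W′ (perfect relaxation ⇒ `ÊSS ≤ exp(−Σ_k D(p_{k+1}‖p_k))`; proved).** -/
theorem ess_perfect_relaxation_le [Nonempty X] [DecidableEq X] (S : Fin (n+1) → X → ℝ) :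
    essFrac (revPathLaw S (fun k _ y => gibbsLaw (S k.succ) y))
        (pathLaw (gibbsLaw (S 0)) (fun k _ y => gibbsLaw (S k.succ) y)) ≤
      Real.exp (-(∑ k : Fin n, klFin (gibbsLaw (S k.succ)) (gibbsLaw (S k.castSucc)))) := by
  rw [ess_perfect_relaxation, ← sum_neg_distrib, Real.exp_sum]
  exact prod_le_prod (fun k _ => essFrac_nonneg fun x => (gibbsLaw_pos (S _) x).le)
    fun k _ => essFrac_le_exp_neg_kl (gibbsLaw_pos (S _)) (gibbsLaw_pos (S _)) (sum_gibbsLaw (S _))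

end PathBudgets

end Summit.Ventures.LatticeQCDFlow.Theory2
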